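import Mathlib
import HarnessLib
import Summits.AnomalousDissipation.AnomalousDissipation.Theorems.SolenoidalFractalHomogenisationLagrangianStepCellClauseCutsW
import Summits.AnomalousDissipation.AnomalousDissipation.Theorems.IsotropicCubatureWord

/-!
# K1L_D · S23″ — SUB-STUB CANDIDATE (M′) `HighLabelDecayW` + W7 `stub_highLabelDecay_IS` (planner ad-ideate-p4 g12, lens «control»;
# tenure D24-22 (1) "p4 writes text, lead places it"; registry-neutral)

Crux `LagrangianRenormalisationStepDesign` (stmt-AnomalousDissipation-27980), registered line v3, stub S23″ `stub_windowDefectL` (holder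
`lead-k1l-onelevel-p1`).  Memo of record: `Lines/onelevel-L4c-operator-forms.md` v2 §2 (finding F-p4g12-4): at every window reset the cell-scale
corrector content that the true solution must carry is re-read in the new lattice frame with a LABEL spread `|Δℓ| ≲ Ca·θ₀·ρ^{1/16}·n`, i.e. the
dissipation-weighted deposits land on Bloch fibres `k̃ = |ℓ|/n ∈ (ν/K, Ca·θ₀·ρ^{1/16})` — beyond the homogenisation range `ν/K` of the slow-vector
clause (V) and below the bare per-window kill `k̃ ~ ρ^{1/32}` — where no typed clause of the line speaks.  The missing FLAT input is a ν-UNIFORM decay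
rate `≥ c_K·ν` (cell-problem time units of `CellEnergyClausesW`: cell-scale viscous rate `ν`, one period of the replayed design lasts `M·period/ν`)
for data supported on labels `≥ n·ν/K♭`; per refresh window (`ρ^{-1/16}` periods) this is the super-polynomially small factor
`exp(−2·c_K·M·period·ρ^{−1/16})`, which the window ledger then consumes as a CONTRACTION (L4c §3, (M♭_G)).

* `HighLabelDecayW W M hM lo hi Λ β ν₀ Kb CK cK` — the clause, typed on the prefix of `CellEnergyClausesW` VERBATIM (same `ν, n, 𝔸`, `OddSmall`,
  `NearIso` window, `IsDatum`, `cellField`, weak solutions `Torus.IsWeakTensorPassiveVectorOn 0 T ((1/n²)•𝔸) (cellField W M hM ν _ n) F u`,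
  `∀ᵐ t` energies): for data with NO modes on labels of norm `< L`, `n·ν ≤ Kb·L` (fibres at or beyond `1/Kb` of the cell viscous scale), the energy
  decays like `CK·exp(−2·cK·ν·t)`.  No upper bound on `L` is needed (for `L > n√3/2` the hypothesis forces `F = 0`).  `1 ≤ n` excludes the junk
  instance `n = 0` (zero tensor `(1/0²)•𝔸 = 0`, no decay).  4c checklist: no hand-picked threshold (`Kb` universal, `CK, cK, ν₀` existential and
  allowed to depend on `M, lo, hi, Λ, β, Kb`); weak solutions with the energy class implicit (`IsDatum`); degenerate instances true.
* `HighLabelContractW … P₁ φ0` — the PER-PERIOD CONTRACTION form (M♭) (tenure D24-23 (a)); `highLabelContractW_of_decayW` : (M′) ⇒ (M♭).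
* `stub_highLabelDecay_IS` — W7 (flat, XL−): the clause holds for the DESIGN word `cubatureWord` (26 slots, `IsotropicCubatureWord`), every
  pre-stretch `M`, every window, every `Kb ≥ 1`.

WHY PLAUSIBLY TRUE (L4c §2.7/2.7bis; toy kit j315519, evidence #54 on stmt-…-24912).  Reduced to one Bloch fibre `k̃` the cell problem is a
cross-stream chain; for ONE steady sine-shear slot and the polarisation NOT along the slot's gradient direction it is the passive-scalar chain, whose
spectral gap is `ν·g(k̃_s/ν)` with `g(r) = r²/2` (Taylor-homogenised, `r ≲ 2`) and `≈ 9√r` beyond (the `ν^{1/2}k^{1/2}` enhanced-dissipation regime of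
Kolmogorov-type flows: Bedrossian–Coti Zelati arXiv:1510.08098, Wei–Zhang–Zhao arXiv:1711.01822, Coti Zelati–Delgadino–Elgindi arXiv:1806.03258;
relaxation enhancement Constantin–Kiselev–Ryzhik–Zlatoš math/0701321) — measured ν-UNIFORM in `r` (gap/ν = 0.510|0.506 at r = 1, 0.032|0.031 at
r = 1/4 for ν = 10⁻²|10⁻³); the whole reduced generator is `≈ ν·L̃(r, β, geometry)` at `k̃ ~ ν`, which is why the constant is ν-free.  PRESSURE
SHIELDING: the polarisation along the slot's gradient of a stream-aligned fibre couples only at `O(k̃²)` (Leray factor `k̃/√(1+k̃²)` on the links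
`0 ↔ ±1`; toy: gap = bare) — so the statement is per PERIOD, not per slot, and uses that for every (fibre direction `q̂`, polarisation `p ⊥ q̂`) some
slot `(m, v)` of the word has `⟨v̂, q̂⟩ ≠ 0` and `p` not along `proj_{⊥q̂} m̂`: exactly the factor `τ·⟨v̂,q⟩²·(‖p‖² − ⟨p, m̂ − ⟨m̂,q⟩q⟩²)` of
`IsotropicCubatureWord.slotTerm`, and `slotTerm_sum = (280|q|² − 112|q|²|p|² + 56⟨p,q⟩²)/(32π⁴) = 168/(32π⁴) > 0` on `|q̂| = |p| = 1, p ⊥ q̂`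
(coverage with a uniform constant, pigeonhole over the 26 slots).  Above `k̃ ≈ 0.1` the bare sector-Poincaré rate `4π²(lo/Λ)·ν·k̃²` already exceeds
`c_K·ν` (label support is preserved by the flat dynamics; uniqueness `PassiveVectorTensorUniqueness`).  The odd part (`OddSmall … (ν·β)`) detunes the
chain by `O(ν·β·m)` — golden-rule leak rate still `∝ ν` with a β-dependent constant, hence the β-dependence of `cK`.
PROOF ROUTE (brief W7, L4c §2.8): single-slot enhanced/Taylor estimate for the unshielded component (scalar hypocoercivity technology) × cubature
coverage (in tree) × energy non-expansion in the other slots and across ramps ⇒ per-period contraction ⇒ the rate form with `CK` absorbing one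
period; bare Poincaré road above `k̃ ≈ 0.1`.  CHEAPEST FALSIFIER still open: the two-slot period map ((x,y)+(x,z) slots, fibre (k₁,0,0), both
polarisations) — one sparse kit job.

NOT a registry; NOT a proof of the crux, of Onsager's conjecture or of anomalous dissipation (rung F-D1.A0 infrastructure text).  `lean check`: rc 0,
1 sorry (the stub). v2: + (M♭) `HighLabelContractW` and the implication from (M′).
-/

set_option linter.dupNamespace false

namespace Summit.AnomalousDissipation.AnomalousDissipation.Cruxes.LagrangianRenormalisationStepDesign.OneLevelSplit.S23

open Literature.Analysis Literature.Analysis.FluidPDE Literature.Analysis.FunctionSpaces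
open MeasureTheory Set Filter
open scoped ENNReal NNReal InnerProductSpace

noncomputable section

open Summit.AnomalousDissipation.AnomalousDissipation.Theorems.SolenoidalFractalHomogenisation.LagrangianStep

/-- **(M′) HIGH-LABEL DECAY clause** for the design `W.stretch M` replayed quasi-statically at cell viscosity `ν` with `n` cells (prefix of
`CellEnergyClausesW` verbatim).  For every admissible datum `F` carrying NO Fourier modes on Bloch labels of norm `< L` — i.e. `modeCoeff k' F = 0`
whenever `k' = ℓ + n·z` with `‖ℓ‖ < L` — where the label threshold is at or beyond `1/Kb` of the cell viscous scale, `n·ν ≤ Kb·L`, every weak solution of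
the cell problem decays at the ν-UNIFORM rate `cK·ν`:  `∫‖u t‖² ≤ CK·exp(−2·cK·ν·t)·∫‖F‖²` for a.e. `t ∈ (0,T)`. -/
def HighLabelDecayW {k : ℕ} (W : LatticeShear.LatticeWord k) (M : ℝ) (hM : 0 < M) (lo hi Λ β ν₀ Kb CK cK : ℝ) : Prop :=
  ∀ ν, ∀ hν : ν ∈ Set.Ioo 0 ν₀, ∀ n : ℕ, 1 ≤ n → ∀ 𝔸 : Torus.Visc4 (Fin 3),
    Torus.OddSmall 𝔸 (ν * β) → (∃ lam ∈ Set.Icc (1:ℝ) Λ, Torus.NearIso 𝔸 (ν * (lo / lam)) (ν * (hi * lam))) →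
    ∀ L > (0:ℝ), (n : ℝ) * ν ≤ Kb * L →
    ∀ F : VF, IsDatum F →
      (∀ k' : Fin 3 → ℤ, (∃ ℓ z : Fin 3 → ℤ, ‖Torus.latticeVec ℓ‖ < L ∧ k' = ℓ + (n : ℤ) • z) → ∀ i, modeCoeff k' F i = 0) →
      ∀ T > (0:ℝ), ∀ u : ℝ → VF,
        Torus.IsWeakTensorPassiveVectorOn 0 T ((1 / (n:ℝ) ^ 2) • 𝔸) (cellField W M hM ν hν.1 n) F u →
        ∀ᵐ t ∂(volume.restrict (Ioo 0 T)),
          ∫ x, ‖u t x‖ ^ 2 ≤ CK * Real.exp (-(2 * cK * ν * t)) * ∫ x, ‖F x‖ ^ 2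

/-- **W7 `stub_highLabelDecay_IS` (flat, XL−)** — the high-label decay clause (M′) holds for the DESIGN word `cubatureWord`, every pre-stretch
`M > 0`, every transverse window `(lo, hi, Λ, β)` and every range multiplier `Kb ≥ 1`, with constants `CK ≥ 1`, `cK > 0`, `ν₀ > 0` depending on
them (enhanced dissipation on the fibres `ν/Kb ≤ k̃ ≲ 0.1` via single-slot scalar estimates × cubature coverage `IsotropicCubatureWord.slotTerm_sum`;
bare sector-Poincaré above).  SUB-STUB CANDIDATE of S23″ (tenure D24-22); consumed by the window ledger as the per-window contraction (M♭_G). -/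
theorem stub_highLabelDecay_IS : ∀ (M : ℝ) (hM : 0 < M) (lo hi Λ β : ℝ), 0 < lo → lo ≤ 1 → 1 ≤ hi → 1 < Λ → 0 ≤ β →
    ∀ Kb : ℝ, 1 ≤ Kb → ∃ CK : ℝ, 1 ≤ CK ∧ ∃ cK > (0:ℝ), ∃ ν₀ > (0:ℝ),
      HighLabelDecayW Summit.AnomalousDissipation.AnomalousDissipation.Theorems.cubatureWord M hM lo hi Λ β ν₀ Kb CK cK := by
  sorry

/-- **(M♭) HIGH-LABEL CONTRACTION clause** (per-period form, tenure D24-23 (a)): same prefix and hypotheses as `HighLabelDecayW`; conclusion: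
after the ν-scaled waiting time `P₁/ν` (one design period is `P₁ = M·W.period`, `= M·3720` for `cubatureWord`) the energy of every weak solution is at
most the fraction `φ0` of the datum's, for a.e. later `t`.  `HighLabelDecayW` ⇒ this with `P₁ = log(CK/φ0)/(2cK)` for every `φ0 ∈ (0,1)`
(`highLabelContractW_of_decayW`); the converse (iterate the contraction along the flat propagator, `CK = φ0⁻¹`, `cK = log(1/φ0)/(2P₁)`) is W7-internal. -/
def HighLabelContractW {k : ℕ} (W : LatticeShear.LatticeWord k) (M : ℝ) (hM : 0 < M) (lo hi Λ β ν₀ Kb P₁ φ0 : ℝ) : Prop :=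
  ∀ ν, ∀ hν : ν ∈ Set.Ioo 0 ν₀, ∀ n : ℕ, 1 ≤ n → ∀ 𝔸 : Torus.Visc4 (Fin 3),
    Torus.OddSmall 𝔸 (ν * β) → (∃ lam ∈ Set.Icc (1:ℝ) Λ, Torus.NearIso 𝔸 (ν * (lo / lam)) (ν * (hi * lam))) →
    ∀ L > (0:ℝ), (n : ℝ) * ν ≤ Kb * L →
    ∀ F : VF, IsDatum F →
      (∀ k' : Fin 3 → ℤ, (∃ ℓ z : Fin 3 → ℤ, ‖Torus.latticeVec ℓ‖ < L ∧ k' = ℓ + (n : ℤ) • z) → ∀ i, modeCoeff k' F i = 0) →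
      ∀ T > (0:ℝ), ∀ u : ℝ → VF,
        Torus.IsWeakTensorPassiveVectorOn 0 T ((1 / (n:ℝ) ^ 2) • 𝔸) (cellField W M hM ν hν.1 n) F u →
        ∀ᵐ t ∂(volume.restrict (Ioo 0 T)), P₁ / ν ≤ t →
          ∫ x, ‖u t x‖ ^ 2 ≤ φ0 * ∫ x, ‖F x‖ ^ 2

/-- (M′) ⇒ (M♭): the rate form gives the contraction form after the waiting time `log(CK/φ0)/(2cK)/ν`. -/
theorem highLabelContractW_of_decayW {k : ℕ} {W : LatticeShear.LatticeWord k} {M : ℝ} {hM : 0 < M} {lo hi Λ β ν₀ Kb CK cK φ0 : ℝ}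
    (hCK : 0 < CK) (hcK : 0 < cK) (hφ : 0 < φ0) (h : HighLabelDecayW W M hM lo hi Λ β ν₀ Kb CK cK) :
    HighLabelContractW W M hM lo hi Λ β ν₀ Kb (Real.log (CK / φ0) / (2 * cK)) φ0 := by
  intro ν hν n hn 𝔸 hodd hwin L hL hKL F hF hlab T hT u hu
  have hν0 : 0 < ν := hν.1
  filter_upwards [h ν hν n hn 𝔸 hodd hwin L hL hKL F hF hlab T hT u hu] with t ht hPt
  have h1 : Real.log (CK / φ0) ≤ 2 * cK * ν * t := by
    rw [div_div, div_le_iff₀ (by positivity)] at hPt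
    linarith
  have h2 : CK * Real.exp (-(2 * cK * ν * t)) ≤ φ0 := by
    have h3 : Real.exp (-(2 * cK * ν * t)) ≤ φ0 / CK := by
      rw [show φ0 / CK = Real.exp (-Real.log (CK / φ0)) by
        rw [Real.exp_neg, Real.exp_log (by positivity), inv_div]]
      exact Real.exp_le_exp.mpr (by linarith)
    calc CK * Real.exp (-(2 * cK * ν * t)) ≤ CK * (φ0 / CK) := by gcongr
      _ = φ0 := by field_simp
  exact ht.trans (mul_le_mul_of_nonneg_right h2 (integral_nonneg fun _ => by positivity))

/-- Degenerate-instance check (4c (iv)): the clause is monotone in the prefactor — a larger `CK` is weaker. -/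
theorem highLabelDecayW_mono_CK {k : ℕ} {W : LatticeShear.LatticeWord k} {M : ℝ} {hM : 0 < M} {lo hi Λ β ν₀ Kb CK CK' cK : ℝ}
    (hCK : CK ≤ CK') (h : HighLabelDecayW W M hM lo hi Λ β ν₀ Kb CK cK) : HighLabelDecayW W M hM lo hi Λ β ν₀ Kb CK' cK := by
  intro ν hν n hn 𝔸 hodd hwin L hL hKL F hF hlab T hT u hu
  filter_upwards [h ν hν n hn 𝔸 hodd hwin L hL hKL F hF hlab T hT u hu] with t ht
  refine ht.trans ?_
  gcongr

end

end Summit.AnomalousDissipation.AnomalousDissipation.Cruxes.LagrangianRenormalisationStepDesign.OneLevelSplit.S23
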